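import Literature.NumberTheory.LFunctions.ClassGroupSiftedSums
import Literature.NumberTheory.LFunctions.ClassTwistedZetaMeanSquare
import HarnessLib

/-!
# Counting bounds for the class group sieve (towards Thorner–Zaman 2017, Theorem 4.2)

Topic `Literature/NumberTheory/LFunctions`, namespace `Literature.NumberTheory.LFunctions.NumberField`.
Everything here is PROVED (theorems only; no named facts).

Uniform (in the number field `K` of degree `n_K`) elementary bounds entering the main term and the
error term of the sifted class sums `ClassGroupSiftedSums.sifted_classSum_le`:

* `card_idealsNormLE_le` — `#{𝔫 ≠ 0 : N𝔫 ≤ X} ≤ X^{n_K + 1}` (`c_K(n) ≤ τ(n)^{n_K} ≤ n^{n_K}`,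
  tree `idealNormCount_le_card_divisors_pow`);
* `sqfIdeal_injective`, `card_admissible_le` — `|D_z| ≤ #{𝔫 ≠ 0 : N𝔫 ≤ z} ≤ z^{n_K+1}`.

## References

* [ThornerZaman2017] J. Thorner, A. Zaman, *An explicit bound for the least prime ideal in the
  Chebotarev density theorem*, Algebra Number Theory 11 (2017), §4 (proof of Theorem 4.2).
* [Weiss1983] A. Weiss, *The least prime ideal*, J. reine angew. Math. 338 (1983), §3.
-/

noncomputable section

open Real Finset IsDedekindDomain Filter
open scoped Topology

namespace Literature.NumberTheory.LFunctions.NumberField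

open Literature.NumberTheory.LFunctions.WeissKernel Literature.NumberTheory.Sieve.Squarefree
open scoped nonZeroDivisors _root_.NumberField Classical

variable {K : Type*} [Field K] [NumberField K]

/-! ### Counting ideals of bounded norm -/

variable (K) in
/-- The nonzero ideals of norm `≤ X`. [folklore] -/
def idealsNormLE (X : ℕ) : Finset (Ideal (𝓞 K)) :=
  (Ideal.finite_setOf_absNorm_le (S := 𝓞 K) X).toFinset.filter (· ≠ ⊥)

/-- Membership in `idealsNormLE`. [folklore] -/
theorem mem_idealsNormLE {X : ℕ} {I : Ideal (𝓞 K)} : I ∈ idealsNormLE K X ↔ I ≠ ⊥ ∧ Ideal.absNorm I ≤ X := by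
  rw [idealsNormLE, mem_filter, Set.Finite.mem_toFinset, Set.mem_setOf_eq, and_comm]

/-- The fibre of the norm in `idealsNormLE` has `c_K(n)` elements (`1 ≤ n ≤ X`). [folklore] -/
theorem card_filter_idealsNormLE_absNorm_eq {X n : ℕ} (hn : n ≠ 0) (hnX : n ≤ X) :
    ((idealsNormLE K X).filter (fun I ↦ Ideal.absNorm I = n)).card = idealNormCount K n := by
  have hset : (idealsNormLE K X).filter (fun I ↦ Ideal.absNorm I = n) =
      (Ideal.finite_setOf_absNorm_eq (S := 𝓞 K) n).toFinset := by
    ext I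
    simp only [mem_filter, mem_idealsNormLE, Set.Finite.mem_toFinset, Set.mem_setOf_eq]
    constructor
    · exact fun h ↦ h.2
    · intro h
      refine ⟨⟨?_, h ▸ hnX⟩, h⟩
      rintro rfl
      rw [Ideal.absNorm_bot] at h
      exact hn h.symm
  rw [hset, idealNormCount, ← Set.ncard_eq_toFinset_card _ (Ideal.finite_setOf_absNorm_eq (S := 𝓞 K) n)]
  rfl

/-- **`#{𝔫 ≠ 0 : N𝔫 ≤ X} ≤ X^{n_K+1}`**, uniformly in `K`. [folklore] -/
theorem card_idealsNormLE_le (X : ℕ) : (idealsNormLE K X).card ≤ X ^ (Module.finrank ℚ K + 1) := by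
  have hfib := Finset.card_eq_sum_card_fiberwise (f := fun I : Ideal (𝓞 K) ↦ Ideal.absNorm I)
    (s := idealsNormLE K X) (t := Finset.Icc 1 X) (fun I hI ↦ by
      rw [Finset.coe_Icc, Set.mem_Icc]
      obtain ⟨h0, hX⟩ := mem_idealsNormLE.mp hI
      exact ⟨Nat.one_le_iff_ne_zero.mpr (mt Ideal.absNorm_eq_zero_iff.mp h0), hX⟩)
  rw [hfib]
  calc ∑ n ∈ Finset.Icc 1 X, ((idealsNormLE K X).filter (fun I ↦ Ideal.absNorm I = n)).card
      ≤ ∑ n ∈ Finset.Icc 1 X, X ^ Module.finrank ℚ K := by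
        refine Finset.sum_le_sum fun n hn ↦ ?_
        rw [Finset.mem_Icc] at hn
        have hn0 : n ≠ 0 := by omega
        rw [card_filter_idealsNormLE_absNorm_eq hn0 hn.2]
        calc idealNormCount K n ≤ n.divisors.card ^ Module.finrank ℚ K := idealNormCount_le_card_divisors_pow hn0
          _ ≤ n ^ Module.finrank ℚ K := Nat.pow_le_pow_left (Nat.card_divisors_le_self n) _
          _ ≤ X ^ Module.finrank ℚ K := Nat.pow_le_pow_left hn.2 _
    _ = X * X ^ Module.finrank ℚ K := by rw [sum_const, Nat.card_Icc, smul_eq_mul]; simp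
    _ = X ^ (Module.finrank ℚ K + 1) := by ring

/-! ### Counting admissible squarefree divisors -/

/-- `v ∈ S ↔ v ∣ 𝔡_S`. [folklore] -/
theorem mem_iff_dvd_sqfIdeal {S : Finset (HeightOneSpectrum (𝓞 K))} {v : HeightOneSpectrum (𝓞 K)} :
    v ∈ S ↔ v.asIdeal ∣ sqfIdeal S := by
  constructor
  · intro hv; exact Finset.dvd_prod_of_mem _ hv
  · intro h
    rw [sqfIdeal, Prime.dvd_finsetProd_iff v.prime] at h
    obtain ⟨w, hw, hvw⟩ := h
    have : v = w := by
      refine HeightOneSpectrum.ext ?_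
      have hle : w.asIdeal ≤ v.asIdeal := Ideal.le_of_dvd hvw
      exact ((w.isMaximal).eq_of_le v.isPrime.ne_top hle).symm
    rwa [this]

/-- `S ↦ 𝔡_S` is injective. [folklore] -/
theorem sqfIdeal_injective : Function.Injective (sqfIdeal (K := K)) := by
  intro S T h
  ext v
  rw [mem_iff_dvd_sqfIdeal, mem_iff_dvd_sqfIdeal, h]

/-- **`|D_z| ≤ #{𝔫 ≠ 0 : N𝔫 ≤ z}`** (`S ↦ 𝔡_S` is injective and `N𝔡_S ≤ z`). [folklore] -/
theorem card_admissible_le {z : ℝ} (hz : 0 ≤ z) : (admissible K z).card ≤ (idealsNormLE K ⌊z⌋₊).card := by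
  refine Finset.card_le_card_of_injOn sqfIdeal (fun S hS ↦ ?_) (sqfIdeal_injective.injOn)
  rw [Finset.mem_coe] at hS
  rw [Finset.mem_coe, mem_idealsNormLE]
  refine ⟨sqfIdeal_ne_bot S, ?_⟩
  rw [Nat.le_floor_iff hz]
  have := (mem_admissible.mp hS).2
  rwa [← absNorm_sqfIdeal] at this

/-- **`|D_z| ≤ z^{n_K+1}`**. [folklore] -/
theorem card_admissible_le_pow {z : ℝ} (hz : 0 ≤ z) :
    ((admissible K z).card : ℝ) ≤ z ^ (Module.finrank ℚ K + 1) := by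
  calc ((admissible K z).card : ℝ) ≤ ((idealsNormLE K ⌊z⌋₊).card : ℝ) := by exact_mod_cast card_admissible_le hz
    _ ≤ ((⌊z⌋₊ : ℕ) : ℝ) ^ (Module.finrank ℚ K + 1) := by exact_mod_cast card_idealsNormLE_le (K := K) ⌊z⌋₊
    _ ≤ z ^ (Module.finrank ℚ K + 1) := pow_le_pow_left₀ (Nat.cast_nonneg _) (Nat.floor_le hz) _

/-! ### `V(z) ≤ e^{n_K} V'(z)`: every ideal is (squarefree) × (square) -/

/-- The multiplicity of `v` in `I`. [folklore] -/
def mult (v : HeightOneSpectrum (𝓞 K)) (I : Ideal (𝓞 K)) : ℕ :=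
  (Associates.mk v.asIdeal).count (Associates.mk I).factors

/-- The prime factors of `I ≠ 0`. [folklore] -/
def primeFactors {I : Ideal (𝓞 K)} (hI : I ≠ ⊥) : Finset (HeightOneSpectrum (𝓞 K)) :=
  (Ideal.finite_factors hI).toFinset

/-- The squarefree part `S(I) = {v : mult_v(I) odd}`. [folklore] -/
def oddPart {I : Ideal (𝓞 K)} (hI : I ≠ ⊥) : Finset (HeightOneSpectrum (𝓞 K)) :=
  (primeFactors hI).filter fun v ↦ Odd (mult v I)

/-- The square part `𝔰(I) = ∏_v v^{⌊mult_v(I)/2⌋}`. [folklore] -/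
def sqPart {I : Ideal (𝓞 K)} (hI : I ≠ ⊥) : Ideal (𝓞 K) :=
  ∏ v ∈ primeFactors hI, v.asIdeal ^ (mult v I / 2)

/-- **`I = 𝔡_{S(I)} · 𝔰(I)²`**. [folklore] -/
theorem sqfIdeal_oddPart_mul_sqPart_sq {I : Ideal (𝓞 K)} (hI : I ≠ ⊥) :
    sqfIdeal (oddPart hI) * sqPart hI ^ 2 = I := by
  have hI0 : I ≠ 0 := by rwa [Ne, Ideal.zero_eq_bot]
  -- both sides as products over the prime factors
  have h1 : sqfIdeal (oddPart hI) = ∏ v ∈ primeFactors hI, v.asIdeal ^ (mult v I % 2) := by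
    rw [sqfIdeal, oddPart, Finset.prod_filter]
    refine Finset.prod_congr rfl fun v _ ↦ ?_
    split_ifs with h
    · rw [Nat.odd_iff.mp h, pow_one]
    · rw [Nat.not_odd_iff.mp h, pow_zero]
  have h2 : sqPart hI ^ 2 = ∏ v ∈ primeFactors hI, v.asIdeal ^ (2 * (mult v I / 2)) := by
    rw [sqPart, ← Finset.prod_pow]
    refine Finset.prod_congr rfl fun v _ ↦ ?_
    rw [← pow_mul, mul_comm]
  rw [h1, h2, ← Finset.prod_mul_distrib]
  have h3 : ∀ v ∈ primeFactors hI, v.asIdeal ^ (mult v I % 2) * v.asIdeal ^ (2 * (mult v I / 2)) =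
      v.maxPowDividing I := by
    intro v _
    rw [← pow_add, Nat.mod_add_div, HeightOneSpectrum.maxPowDividing, mult]
  rw [Finset.prod_congr rfl h3, ← finprod_eq_prod_of_mulSupport_subset _ ?_,
    Ideal.finprod_heightOneSpectrum_factorization hI0]
  intro v hv
  rw [Function.mem_mulSupport] at hv
  rw [Finset.mem_coe, primeFactors, Set.Finite.mem_toFinset, Set.mem_setOf_eq]
  by_contra hdvd
  apply hv
  rw [HeightOneSpectrum.maxPowDividing]
  have : (Associates.mk v.asIdeal).count (Associates.mk I).factors = 0 := by
    by_contra hc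
    exact hdvd ((Associates.count_ne_zero_iff_dvd hI0 v.irreducible).mp hc)
  rw [this, pow_zero]

/-- `𝔰(I) ≠ 0`. [folklore] -/
theorem sqPart_ne_bot {I : Ideal (𝓞 K)} (hI : I ≠ ⊥) : sqPart hI ≠ ⊥ := by
  rw [sqPart, Ne, ← Ideal.zero_eq_bot, Finset.prod_eq_zero_iff]
  push Not
  intro v _
  exact pow_ne_zero _ (by rw [Ideal.zero_eq_bot]; exact v.ne_bot)

/-- `N I = N𝔡_{S(I)} · N𝔰(I)²`. [folklore] -/
theorem absNorm_eq_oddPart_sqPart {I : Ideal (𝓞 K)} (hI : I ≠ ⊥) :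
    (Ideal.absNorm I : ℝ) =
      nrm (fun v : HeightOneSpectrum (𝓞 K) ↦ (Ideal.absNorm v.asIdeal : ℝ)) (oddPart hI) *
        (Ideal.absNorm (sqPart hI) : ℝ) ^ 2 := by
  conv_lhs => rw [← sqfIdeal_oddPart_mul_sqPart_sq hI]
  rw [map_mul, map_pow, Nat.cast_mul, Nat.cast_pow, absNorm_sqfIdeal]

/-- For `N I ≤ z`: `S(I) ∈ D_z`. [folklore] -/
theorem oddPart_mem_admissible {z : ℝ} {I : Ideal (𝓞 K)} (hI : I ≠ ⊥) (hIz : (Ideal.absNorm I : ℝ) ≤ z) :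
    oddPart hI ∈ admissible K z := by
  have hz : 0 ≤ z := le_trans (Nat.cast_nonneg _) hIz
  have hNI : (0 : ℝ) < Ideal.absNorm I := by
    exact_mod_cast Nat.pos_of_ne_zero (mt Ideal.absNorm_eq_zero_iff.mp hI)
  rw [mem_admissible]
  constructor
  · intro v hv
    rw [oddPart, mem_filter, primeFactors, Set.Finite.mem_toFinset, Set.mem_setOf_eq] at hv
    rw [mem_primesLE hz]
    have hdvd : Ideal.absNorm v.asIdeal ∣ Ideal.absNorm I := map_dvd Ideal.absNorm hv.1
    have := Nat.le_of_dvd (Nat.pos_of_ne_zero (mt Ideal.absNorm_eq_zero_iff.mp hI)) hdvd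
    exact le_trans (by exact_mod_cast this) hIz
  · rw [absNorm_eq_oddPart_sqPart hI] at hIz
    have hs : (1 : ℝ) ≤ (Ideal.absNorm (sqPart hI) : ℝ) ^ 2 := by
      have : (1 : ℝ) ≤ Ideal.absNorm (sqPart hI) := by
        exact_mod_cast Nat.one_le_iff_ne_zero.mpr (mt Ideal.absNorm_eq_zero_iff.mp (sqPart_ne_bot hI))
      nlinarith
    have hn := (nrm_pos (N := fun v : HeightOneSpectrum (𝓞 K) ↦ (Ideal.absNorm v.asIdeal : ℝ)) one_lt_absNorm_real (oddPart hI)).le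
    nlinarith

/-- For `N I ≤ X`: `𝔰(I) ∈ idealsNormLE X`. [folklore] -/
theorem sqPart_mem_idealsNormLE {X : ℕ} {I : Ideal (𝓞 K)} (hI : I ≠ ⊥) (hIX : Ideal.absNorm I ≤ X) :
    sqPart hI ∈ idealsNormLE K X := by
  rw [mem_idealsNormLE]
  refine ⟨sqPart_ne_bot hI, le_trans ?_ hIX⟩
  have h := absNorm_eq_oddPart_sqPart hI
  have hn := one_le_nrm (N := fun v : HeightOneSpectrum (𝓞 K) ↦ (Ideal.absNorm v.asIdeal : ℝ)) one_lt_absNorm_real (oddPart hI)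
  have hs : (1 : ℝ) ≤ (Ideal.absNorm (sqPart hI) : ℝ) := by
    exact_mod_cast Nat.one_le_iff_ne_zero.mpr (mt Ideal.absNorm_eq_zero_iff.mp (sqPart_ne_bot hI))
  have : (Ideal.absNorm (sqPart hI) : ℝ) ≤ Ideal.absNorm I := by rw [h]; nlinarith
  exact_mod_cast this

/-- **`Σ_{0 < N𝔰 ≤ X} N𝔰^{−2} ≤ e^{n_K}`** (`≤ ζ_K(2) ≤ e^{n_K}`, tree `hasSum_absNorm_cpow`,
`norm_dedekindZeta_le_exp_finrank_div`). [folklore] -/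
theorem sum_idealsNormLE_absNorm_inv_sq_le (X : ℕ) :
    ∑ I ∈ idealsNormLE K X, ((Ideal.absNorm I : ℝ) ^ 2)⁻¹ ≤ Real.exp (Module.finrank ℚ K) := by
  have h2 : (1 : ℝ) < (2 : ℂ).re := by norm_num
  have hH := Literature.NumberTheory.LFunctions.hasSum_absNorm_cpow K h2
  have hre := Complex.reCLM.hasSum hH
  have hterm : ∀ I : Ideal (𝓞 K), Complex.reCLM (((Ideal.absNorm I : ℕ) : ℂ) ^ (-(2 : ℂ))) =
      ((Ideal.absNorm I : ℝ) ^ 2)⁻¹ := by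
    intro I
    rw [Complex.reCLM_apply, show (-(2 : ℂ)) = ((-2 : ℤ) : ℂ) by norm_num, Complex.cpow_intCast]
    rw [show ((Ideal.absNorm I : ℕ) : ℂ) = ((Ideal.absNorm I : ℝ) : ℂ) by simp, ← Complex.ofReal_zpow,
      Complex.ofReal_re, zpow_neg, zpow_ofNat]
  simp_rw [hterm] at hre
  have hle := sum_le_hasSum (idealsNormLE K X) (fun I _ ↦ by positivity) hre
  refine hle.trans ?_
  rw [Complex.reCLM_apply]
  refine (Complex.re_le_norm _).trans ?_
  have := norm_dedekindZeta_le_exp_finrank_div K h2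
  norm_num at this
  exact this

/-- **`V(z) ≤ e^{n_K} V'(z)`**: `Σ_{0 < N𝔫 ≤ z} 1/N𝔫 ≤ e^{n_K} Σ_{S ∈ D_z} 1/N𝔡_S` (`𝔫 = 𝔡_{S(𝔫)}𝔰(𝔫)²`
injectively, `S(𝔫) ∈ D_z`, `N𝔰 ≤ z`, and `Σ N𝔰^{−2} ≤ e^{n_K}`). [folklore] -/
theorem sum_idealsNormLE_inv_le {z : ℝ} (hz : 0 ≤ z) :
    ∑ I ∈ idealsNormLE K ⌊z⌋₊, (Ideal.absNorm I : ℝ)⁻¹ ≤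
      Real.exp (Module.finrank ℚ K) *
        bigV (fun v : HeightOneSpectrum (𝓞 K) ↦ (Ideal.absNorm v.asIdeal : ℝ)) (admissible K z) := by
  set Nf : HeightOneSpectrum (𝓞 K) → ℝ := fun v ↦ (Ideal.absNorm v.asIdeal : ℝ) with hNf
  -- the decomposition map
  set g : Ideal (𝓞 K) → Finset (HeightOneSpectrum (𝓞 K)) × Ideal (𝓞 K) := fun I ↦
    if hI : I = ⊥ then (∅, ⊥) else (oddPart hI, sqPart hI) with hg
  set f : Finset (HeightOneSpectrum (𝓞 K)) × Ideal (𝓞 K) → ℝ := fun p ↦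
    (1 / nrm Nf p.1) * ((Ideal.absNorm p.2 : ℝ) ^ 2)⁻¹ with hf
  have hf0 : ∀ p, 0 ≤ f p := fun p ↦ by
    have := nrm_pos (N := Nf) one_lt_absNorm_real p.1
    rw [hf]; positivity
  -- termwise
  have hterm : ∀ I ∈ idealsNormLE K ⌊z⌋₊, (Ideal.absNorm I : ℝ)⁻¹ = f (g I) := by
    intro I hI
    obtain ⟨hI0, -⟩ := mem_idealsNormLE.mp hI
    rw [hg, hf]; dsimp only
    rw [dif_neg hI0]; dsimp only
    rw [absNorm_eq_oddPart_sqPart hI0, hNf]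
    field_simp
  -- `g` maps into `D_z × idealsNormLE` injectively
  have hmaps : ∀ I ∈ idealsNormLE K ⌊z⌋₊, g I ∈ admissible K z ×ˢ idealsNormLE K ⌊z⌋₊ := by
    intro I hI
    obtain ⟨hI0, hIX⟩ := mem_idealsNormLE.mp hI
    rw [hg]; dsimp only
    rw [dif_neg hI0, Finset.mem_product]
    exact ⟨oddPart_mem_admissible hI0 (le_trans (by exact_mod_cast hIX) (Nat.floor_le hz)),
      sqPart_mem_idealsNormLE hI0 hIX⟩
  have hinj : Set.InjOn g (idealsNormLE K ⌊z⌋₊ : Set (Ideal (𝓞 K))) := by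
    intro I hI J hJ hIJ
    rw [Finset.mem_coe] at hI hJ
    obtain ⟨hI0, -⟩ := mem_idealsNormLE.mp hI
    obtain ⟨hJ0, -⟩ := mem_idealsNormLE.mp hJ
    rw [hg] at hIJ; dsimp only at hIJ
    rw [dif_neg hI0, dif_neg hJ0, Prod.mk.injEq] at hIJ
    rw [← sqfIdeal_oddPart_mul_sqPart_sq hI0, ← sqfIdeal_oddPart_mul_sqPart_sq hJ0, hIJ.1, hIJ.2]
  calc ∑ I ∈ idealsNormLE K ⌊z⌋₊, (Ideal.absNorm I : ℝ)⁻¹ = ∑ I ∈ idealsNormLE K ⌊z⌋₊, f (g I) := sum_congr rfl hterm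
    _ = ∑ p ∈ (idealsNormLE K ⌊z⌋₊).image g, f p := (sum_image fun I hI J hJ h ↦ hinj hI hJ h).symm
    _ ≤ ∑ p ∈ admissible K z ×ˢ idealsNormLE K ⌊z⌋₊, f p := by
        refine sum_le_sum_of_subset_of_nonneg ?_ fun p _ _ ↦ hf0 p
        intro p hp
        obtain ⟨I, hI, rfl⟩ := mem_image.mp hp
        exact hmaps I hI
    _ = (∑ S ∈ admissible K z, 1 / nrm Nf S) * ∑ 𝔰 ∈ idealsNormLE K ⌊z⌋₊, ((Ideal.absNorm 𝔰 : ℝ) ^ 2)⁻¹ := by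
        rw [sum_product, sum_mul]
        refine sum_congr rfl fun S _ ↦ ?_
        rw [mul_sum]
    _ ≤ (∑ S ∈ admissible K z, 1 / nrm Nf S) * Real.exp (Module.finrank ℚ K) := by
        refine mul_le_mul_of_nonneg_left (sum_idealsNormLE_absNorm_inv_sq_le _) ?_
        exact sum_nonneg fun S _ ↦ (one_div_pos.mpr (nrm_pos one_lt_absNorm_real S)).le
    _ = Real.exp (Module.finrank ℚ K) * bigV Nf (admissible K z) := by rw [bigV, mul_comm]

/-! ### `Z₁(1) = κ_K`, the residue of `ζ_K` -/

/-- **`Z₁(1) = κ_K`**: the value at `1` of the entire `(s−1)ζ_K(s)` is Mathlib's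
`dedekindZeta_residue K = 2^{r₁}(2π)^{r₂} R_K h_K/(w_K √|d_K|)` (both are the limit of
`(σ − 1)ζ_K(σ)` as `σ → 1⁺`, `NumberField.tendsto_sub_one_mul_dedekindZeta_nhdsGT`). [folklore] -/
theorem classTwistedZeta₁_one_one_eq_residue :
    classTwistedZeta₁ K (fun _ ↦ (1 : ℂ)) 1 = (NumberField.dedekindZeta_residue K : ℂ) := by
  have hcont : Continuous fun σ : ℝ ↦ classTwistedZeta₁ K (fun _ ↦ (1 : ℂ)) σ :=
    (differentiable_classTwistedZeta₁ (K := K) _).continuous.comp Complex.continuous_ofReal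
  have h1 : Tendsto (fun σ : ℝ ↦ classTwistedZeta₁ K (fun _ ↦ (1 : ℂ)) σ) (𝓝[>] 1)
      (𝓝 (classTwistedZeta₁ K (fun _ ↦ (1 : ℂ)) 1)) := by
    have := hcont.tendsto 1
    simp only [Complex.ofReal_one] at this
    exact this.mono_left nhdsWithin_le_nhds
  have h2 : Tendsto (fun σ : ℝ ↦ classTwistedZeta₁ K (fun _ ↦ (1 : ℂ)) σ) (𝓝[>] 1)
      (𝓝 (NumberField.dedekindZeta_residue K : ℂ)) := by
    have hlim := NumberField.tendsto_sub_one_mul_dedekindZeta_nhdsGT K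
    refine hlim.congr' ?_
    filter_upwards [self_mem_nhdsWithin] with σ hσ
    rw [Set.mem_Ioi] at hσ
    have hσ1 : (σ : ℂ) ≠ 1 := by
      intro h; have := congrArg Complex.re h; simp at this; linarith
    rw [classTwistedZeta₁_apply_of_ne_one _ hσ1, classTwistedZeta_one hσ1,
      dedekindZetaCont_eq_dedekindZeta_holds (K := K) (by simpa using hσ)]
  exact tendsto_nhds_unique h1 h2

/-- `Re(Z₁(1)) = κ_K > 0`. [folklore] -/
theorem re_classTwistedZeta₁_one_one :
    (classTwistedZeta₁ K (fun _ ↦ (1 : ℂ)) 1).re = NumberField.dedekindZeta_residue K := by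
  rw [classTwistedZeta₁_one_one_eq_residue, Complex.ofReal_re]

/-! ### The smoothed sum over all ideals and the window sums -/

/-- The error of Lemma 4.4: `err(u) = (1/3)|d_K|e^{2n_K} C e^{−3u/2}`. [folklore] -/
def lemma44Err (K : Type*) [Field K] [NumberField K] (A : ℝ) (m : ℕ) (u : ℝ) : ℝ :=
  1 / 3 * (((NumberField.discr K).natAbs : ℝ) * Real.exp (2 * Module.finrank ℚ K)) *
    majorConst A m (Module.finrank ℚ K + 1) * Real.exp (-(3 / 2 * u))

/-- `err` is antitone in `u`. [folklore] -/
theorem lemma44Err_antitone (A : ℝ) (m : ℕ) {u v : ℝ} (huv : u ≤ v) :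
    lemma44Err K A m v ≤ lemma44Err K A m u := by
  rw [lemma44Err, lemma44Err]
  have := majorConst_pos A m (Module.finrank ℚ K + 1)
  refine mul_le_mul_of_nonneg_left (Real.exp_le_exp.mpr (by linarith)) (by positivity)

/-- **The smoothed sum over all nonzero ideals is `≥ κ_K − h·err(u)`**:
`Σ_{𝔫 ≠ 0} N𝔫^{−1} φ(u − log N𝔫) = Σ_C S_C(u) ≥ κ_K − h_K err(u)`. [folklore] -/
theorem residue_sub_le_sum_phi {A : ℝ} (hA : 0 < A) {m : ℕ} (hm : Module.finrank ℚ K + 3 ≤ m) (u : ℝ) :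
    NumberField.dedekindZeta_residue K - Fintype.card (ClassGroup (𝓞 K)) * lemma44Err K A m u ≤
      ∑ I ∈ idealsNormLE K ⌊Real.exp (u + ((m : ℝ) + 1) / A)⌋₊,
        ((Ideal.absNorm I : ℕ) : ℝ)⁻¹ * phi A m (u - Real.log (Ideal.absNorm I)) := by
  set X := ⌊Real.exp (u + ((m : ℝ) + 1) / A)⌋₊ with hX
  set h : ℕ := Fintype.card (ClassGroup (𝓞 K)) with hh
  set κc : ℂ := classTwistedZeta₁ K (fun _ ↦ (1 : ℂ)) 1 / Fintype.card (ClassGroup (𝓞 K)) with hκc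
  -- class sums as real finite sums
  set SC : ClassGroup (𝓞 K) → ℝ := fun C ↦ ∑ I ∈ idealsNormLE K X,
    (if idealClass I = C then (1 : ℝ) else 0) * (((Ideal.absNorm I : ℕ) : ℝ)⁻¹ *
      phi A m (u - Real.log (Ideal.absNorm I))) with hSC
  have hSCeq : ∀ C, classSmoothedSum K C A m u = ((SC C : ℝ) : ℂ) := by
    intro C
    rw [classSmoothedSum, tsum_eq_sum (s := idealsNormLE K X)]
    · rw [hSC]; dsimp only
      rw [Complex.ofReal_sum]
      refine Finset.sum_congr rfl fun I hI ↦ ?_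
      obtain ⟨hI0, -⟩ := mem_idealsNormLE.mp hI
      by_cases hC : idealClass I = C
      · rw [if_pos ⟨hI0, hC⟩, if_pos hC]; push_cast; ring
      · rw [if_neg (fun h ↦ hC h.2), if_neg hC]; push_cast; ring
    · intro I hI
      by_cases hI0 : I = ⊥
      · rw [if_neg (fun h ↦ h.1 hI0), zero_mul, zero_mul]
      · have hgt : X < Ideal.absNorm I := by
          by_contra hle
          exact hI (mem_idealsNormLE.mpr ⟨hI0, not_lt.mp hle⟩)
        have : Real.exp (u + ((m : ℝ) + 1) / A) < Ideal.absNorm I := (Nat.floor_lt (Real.exp_pos _).le).mp hgt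
        rw [phi_sub_log_eq_zero hA m u this]
        simp
  -- per class lower bound
  have hcls : ∀ C, κc.re - lemma44Err K A m u ≤ SC C := by
    intro C
    have hb := norm_classSmoothedSum_sub_le C hA hm u
    rw [hSCeq C] at hb
    have := (Complex.abs_re_le_norm (((SC C : ℝ) : ℂ) - κc)).trans hb
    rw [Complex.sub_re, Complex.ofReal_re] at this
    rw [lemma44Err]
    linarith [(abs_le.mp this).1]
  -- sum over classes
  have hsumC : ∑ C : ClassGroup (𝓞 K), SC C =
      ∑ I ∈ idealsNormLE K X, ((Ideal.absNorm I : ℕ) : ℝ)⁻¹ * phi A m (u - Real.log (Ideal.absNorm I)) := by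
    rw [hSC]; dsimp only
    rw [Finset.sum_comm]
    refine Finset.sum_congr rfl fun I _ ↦ ?_
    rw [← Finset.sum_mul, Finset.sum_ite_eq univ (idealClass I), if_pos (mem_univ _), one_mul]
  have hκ : ∑ _C : ClassGroup (𝓞 K), κc.re = NumberField.dedekindZeta_residue K := by
    rw [sum_const, card_univ, nsmul_eq_mul, hκc, Complex.div_natCast_re, re_classTwistedZeta₁_one_one, ← hh]
    have : (h : ℝ) ≠ 0 := by rw [hh]; exact_mod_cast Fintype.card_ne_zero
    field_simp
  calc NumberField.dedekindZeta_residue K - h * lemma44Err K A m u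
      = ∑ C : ClassGroup (𝓞 K), (κc.re - lemma44Err K A m u) := by
        rw [sum_sub_distrib, hκ, sum_const, card_univ, nsmul_eq_mul, hh]
    _ ≤ ∑ C : ClassGroup (𝓞 K), SC C := sum_le_sum fun C _ ↦ hcls C
    _ = _ := hsumC

/-- **The window sum**: since `0 ≤ φ ≤ A/2` and `φ(u − log N) = 0` unless `e^{u−(m+1)/A} ≤ N ≤ e^{u+(m+1)/A}`,
`(2/A)(κ_K − h err(u)) ≤ Σ_{e^{u−(m+1)/A} ≤ N𝔫 ≤ e^{u+(m+1)/A}} 1/N𝔫`. [folklore] -/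
theorem window_sum_ge {A : ℝ} (hA : 0 < A) {m : ℕ} (hm : Module.finrank ℚ K + 3 ≤ m) (u : ℝ) :
    2 / A * (NumberField.dedekindZeta_residue K - Fintype.card (ClassGroup (𝓞 K)) * lemma44Err K A m u) ≤
      ∑ I ∈ (idealsNormLE K ⌊Real.exp (u + ((m : ℝ) + 1) / A)⌋₊).filter
          (fun I ↦ Real.exp (u - ((m : ℝ) + 1) / A) ≤ Ideal.absNorm I),
        ((Ideal.absNorm I : ℕ) : ℝ)⁻¹ := by
  have h1 := residue_sub_le_sum_phi hA hm u
  set X := ⌊Real.exp (u + ((m : ℝ) + 1) / A)⌋₊ with hX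
  have h2 : ∑ I ∈ idealsNormLE K X, ((Ideal.absNorm I : ℕ) : ℝ)⁻¹ * phi A m (u - Real.log (Ideal.absNorm I)) ≤
      ∑ I ∈ (idealsNormLE K X).filter (fun I ↦ Real.exp (u - ((m : ℝ) + 1) / A) ≤ Ideal.absNorm I),
        ((Ideal.absNorm I : ℕ) : ℝ)⁻¹ * (A / 2) := by
    rw [sum_filter]
    refine sum_le_sum fun I hI ↦ ?_
    obtain ⟨hI0, -⟩ := mem_idealsNormLE.mp hI
    have hN : (0 : ℝ) < (Ideal.absNorm I : ℕ) := by
      exact_mod_cast Nat.pos_of_ne_zero (mt Ideal.absNorm_eq_zero_iff.mp hI0)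
    split_ifs with hw
    · exact mul_le_mul_of_nonneg_left (phi_le hA m _) (by positivity)
    · rw [not_le] at hw
      have hlog : Real.log (Ideal.absNorm I : ℕ) < u - ((m : ℝ) + 1) / A := by
        rw [← Real.exp_lt_exp, Real.exp_log hN]; exact_mod_cast hw
      have hk : 0 < ((m : ℝ) + 1) / A := by positivity
      rw [phi_eq_zero_of_lt hA m (by rw [abs_of_pos (by linarith)]; linarith), mul_zero]
  have h3 := h1.trans h2
  rw [← sum_mul] at h3
  rw [div_mul_eq_mul_div, div_le_iff₀ hA]
  linarith

/-! ### `V(z) ≫ κ_K log z` by disjoint windows -/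

/-- At most two of the points `u₀ + 2jδ` (`j ∈ ℕ`) are within `δ > 0` of a given real `t`. [folklore] -/
theorem card_filter_abs_sub_le_two {u₀ δ t : ℝ} (hδ : 0 < δ) (J : ℕ) :
    ((Finset.range J).filter (fun j : ℕ ↦ |t - (u₀ + 2 * j * δ)| ≤ δ)).card ≤ 2 := by
  set F := (Finset.range J).filter (fun j : ℕ ↦ |t - (u₀ + 2 * j * δ)| ≤ δ) with hF
  rcases F.eq_empty_or_nonempty with h0 | hne
  · rw [h0]; simp
  · have hclose : ∀ j ∈ F, ∀ j' ∈ F, (j : ℝ) ≤ j' + 1 := by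
      intro j hj j' hj'
      have h1 := (abs_le.mp (mem_filter.mp hj).2)
      have h2 := (abs_le.mp (mem_filter.mp hj').2)
      by_contra hlt
      rw [not_le] at hlt
      nlinarith [h1.1, h1.2, h2.1, h2.2]
    set j₀ := F.min' hne with hj₀
    have hsub : F ⊆ Finset.Icc j₀ (j₀ + 1) := by
      intro j hj
      rw [Finset.mem_Icc]
      refine ⟨F.min'_le j hj, ?_⟩
      have := hclose j hj j₀ (F.min'_mem hne)
      exact_mod_cast this
    calc F.card ≤ (Finset.Icc j₀ (j₀ + 1)).card := card_le_card hsub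
      _ = 2 := by rw [Nat.card_Icc]; omega

/-- **`V(z) ≥ κ_K (log z − u₀ − (m+1)/A)/(4(m+1))`** whenever `h_K err(u₀) ≤ κ_K/2` and
`e^{u₀+(m+1)/A} ≤ z`: sum `window_sum_ge` over the `⌊·⌋ + 1` disjoint-up-to-endpoints windows
centred at `u₀ + 2j(m+1)/A` inside `N𝔫 ≤ z` (each ideal lies in at most two windows).
No Euler–Kronecker constant is needed (compare [ThornerZaman2017, Cor. 2.9]). [folklore] -/
theorem residue_mul_log_le_sum_inv {A : ℝ} (hA : 0 < A) {m : ℕ} (hm : Module.finrank ℚ K + 3 ≤ m)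
    {u₀ : ℝ} (hu₀ : Fintype.card (ClassGroup (𝓞 K)) * lemma44Err K A m u₀ ≤ NumberField.dedekindZeta_residue K / 2)
    {z : ℝ} (hz : Real.exp (u₀ + ((m : ℝ) + 1) / A) ≤ z) :
    NumberField.dedekindZeta_residue K * (Real.log z - u₀ - ((m : ℝ) + 1) / A) / (4 * ((m : ℝ) + 1)) ≤
      ∑ I ∈ idealsNormLE K ⌊z⌋₊, ((Ideal.absNorm I : ℕ) : ℝ)⁻¹ := by
  set κ := NumberField.dedekindZeta_residue K with hκ
  set δ : ℝ := ((m : ℝ) + 1) / A with hδ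
  have hδ0 : 0 < δ := by positivity
  have hz0 : 0 < z := lt_of_lt_of_le (Real.exp_pos _) hz
  have hLz : u₀ + δ ≤ Real.log z := by rw [← Real.exp_le_exp, Real.exp_log hz0]; exact hz
  set L : ℝ := Real.log z - u₀ - δ with hL
  have hL0 : 0 ≤ L := by rw [hL]; linarith
  set J : ℕ := ⌊L / (2 * δ)⌋₊ + 1 with hJ
  set uj : ℕ → ℝ := fun j ↦ u₀ + 2 * j * δ with huj
  -- each window
  have hwin : ∀ j : ℕ, j < J → κ / A ≤
      ∑ I ∈ (idealsNormLE K ⌊z⌋₊).filter (fun I ↦ |Real.log (Ideal.absNorm I : ℕ) - uj j| ≤ δ),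
        ((Ideal.absNorm I : ℕ) : ℝ)⁻¹ := by
    intro j hj
    have hj' : (j : ℝ) ≤ L / (2 * δ) := by
      have : j ≤ ⌊L / (2 * δ)⌋₊ := by omega
      exact le_trans (by exact_mod_cast this) (Nat.floor_le (by positivity))
    have hujle : uj j + δ ≤ Real.log z := by
      rw [huj]; dsimp only
      have : 2 * (j : ℝ) * δ ≤ L := by
        rw [le_div_iff₀ (by positivity)] at hj'; linarith
      rw [hL] at this; linarith
    have hu0j : u₀ ≤ uj j := by
      rw [huj]; dsimp only
      have : (0 : ℝ) ≤ 2 * j * δ := by positivity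
      linarith
    have hw := window_sum_ge hA hm (uj j)
    -- lower bound of the window sum by `κ/A`
    have hlow : κ / A ≤ 2 / A * (κ - Fintype.card (ClassGroup (𝓞 K)) * lemma44Err K A m (uj j)) := by
      have herr := lemma44Err_antitone (K := K) A m hu0j
      have hcard : (0 : ℝ) ≤ Fintype.card (ClassGroup (𝓞 K)) := Nat.cast_nonneg _
      have hce : (Fintype.card (ClassGroup (𝓞 K)) : ℝ) * lemma44Err K A m (uj j) ≤ κ / 2 :=
        (mul_le_mul_of_nonneg_left herr hcard).trans hu₀
      have h2 : κ ≤ 2 * (κ - Fintype.card (ClassGroup (𝓞 K)) * lemma44Err K A m (uj j)) := by linarith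
      rw [div_mul_eq_mul_div, div_le_div_iff₀ hA hA]
      exact mul_le_mul_of_nonneg_right h2 hA.le
    refine hlow.trans (hw.trans ?_)
    -- the window finset is contained in the filtered `idealsNormLE ⌊z⌋₊`
    refine sum_le_sum_of_subset_of_nonneg ?_ fun I _ _ ↦ by positivity
    intro I hI
    rw [mem_filter] at hI ⊢
    obtain ⟨hI1, hI2⟩ := hI
    obtain ⟨hI0, hIX⟩ := mem_idealsNormLE.mp hI1
    have hN : (0 : ℝ) < (Ideal.absNorm I : ℕ) := by
      exact_mod_cast Nat.pos_of_ne_zero (mt Ideal.absNorm_eq_zero_iff.mp hI0)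
    have hup : ((Ideal.absNorm I : ℕ) : ℝ) ≤ Real.exp (uj j + δ) := by
      refine le_trans ?_ (Nat.floor_le (Real.exp_pos _).le)
      have : ((m : ℝ) + 1) / A = δ := rfl
      rw [this] at hIX
      exact_mod_cast hIX
    refine ⟨mem_idealsNormLE.mpr ⟨hI0, ?_⟩, ?_⟩
    · rw [Nat.le_floor_iff hz0.le]
      refine hup.trans ?_
      rw [← Real.exp_log hz0]
      exact Real.exp_le_exp.mpr hujle
    · rw [abs_le]
      constructor
      · have := Real.log_le_log (Real.exp_pos _) hI2
        rw [Real.log_exp] at this; linarith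
      · have := Real.log_le_log hN hup
        rw [Real.log_exp] at this; linarith
  -- sum over the windows, each ideal at most twice
  have hsum : ∑ j ∈ Finset.range J,
      ∑ I ∈ (idealsNormLE K ⌊z⌋₊).filter (fun I ↦ |Real.log (Ideal.absNorm I : ℕ) - uj j| ≤ δ),
        ((Ideal.absNorm I : ℕ) : ℝ)⁻¹ ≤ 2 * ∑ I ∈ idealsNormLE K ⌊z⌋₊, ((Ideal.absNorm I : ℕ) : ℝ)⁻¹ := by
    simp_rw [sum_filter]
    rw [sum_comm, mul_sum]
    refine sum_le_sum fun I _ ↦ ?_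
    rw [← sum_filter, sum_const, nsmul_eq_mul]
    refine mul_le_mul_of_nonneg_right ?_ (by positivity)
    have := card_filter_abs_sub_le_two (u₀ := u₀) (t := Real.log (Ideal.absNorm I : ℕ)) hδ0 J
    have e : (Finset.range J).filter (fun a ↦ |Real.log (Ideal.absNorm I : ℕ) - uj a| ≤ δ) =
        (Finset.range J).filter (fun j : ℕ ↦ |Real.log (Ideal.absNorm I : ℕ) - (u₀ + 2 * j * δ)| ≤ δ) := by
      rfl
    rw [e]
    exact_mod_cast this
  have hJsum : (J : ℝ) * (κ / A) ≤ ∑ j ∈ Finset.range J,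
      ∑ I ∈ (idealsNormLE K ⌊z⌋₊).filter (fun I ↦ |Real.log (Ideal.absNorm I : ℕ) - uj j| ≤ δ),
        ((Ideal.absNorm I : ℕ) : ℝ)⁻¹ := by
    have := sum_le_sum fun j (hj : j ∈ Finset.range J) ↦ hwin j (mem_range.mp hj)
    rwa [sum_const, card_range, nsmul_eq_mul] at this
  have hJge : L / (2 * δ) ≤ J := by
    rw [hJ]; push_cast
    exact (Nat.lt_floor_add_one _).le
  have hκ0 : 0 < κ := NumberField.dedekindZeta_residue_pos K
  -- assemble: `κ L/(4(m+1)) = (κ/A) (L/(2δ)) / 2 ≤ (κ/A) J / 2 ≤ V`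
  have e : κ * L / (4 * ((m : ℝ) + 1)) = (L / (2 * δ)) * (κ / A) / 2 := by
    rw [hδ]; field_simp; ring
  rw [e]
  have h1 : (L / (2 * δ)) * (κ / A) / 2 ≤ (J : ℝ) * (κ / A) / 2 := by
    have : 0 ≤ κ / A := by positivity
    nlinarith
  linarith

end Literature.NumberTheory.LFunctions.NumberField

end
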